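import Summits.ABC.IUTFork.LDHGenuineStepV
import HarnessLib

/-!
# The fork at [IUTchIII] Corollary 3.12, L-DH level: [IUTchIV] Thm. 1.10 Steps (v)–(viii) for the GENUINE datum,
# SUMMED over the support primes — the nonarchimedean part of `Thm110Numerics.ProofData.hull_le` / the
# route-level `HullVolumeAtDatum` constant (abc-iut cell, ThetaPartII layer-2 edge (ii′))

Record-only file (D-0012) of the abc-iut cell (WAVE-3 discharge seat abc-iut-c312-d1, gen 3); TAKES NO SIDE.
Mochizuki, *Inter-universal Teichmüller theory IV* (RIMS ms Apr. 2020 = PRIMS **57** (2021)), proof of Thm. 1.10,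
Steps (v)–(viii) pp. 27–30; Dupuy–Hilado, arXiv:2004.13228 §3.3, §3.9, §4.12. Sequel to `LDHGenuineStepV.lean`
(per-prime Step (v) for `DHData.ofInput I` in abc-iut-S3's `DstLocal` currency); here the per-prime bounds are
summed over the support primes `T(I)` (= `{2}` ∪ the primes ramified in `K` ∪ the residue characteristics of
`S`; NOTHING is summed off `T(I)`, so no Step (vi) input is needed):
* `negLogThetaNonarch_le_min` — the `λ_min` form (R2 of plan/c312/STEPV-IND1-NOTE.md; abc-iut-S3's
  `Thm110MinVariant` shape), NO hypothesis on the datum: `negLogThetaNonarch I ≤ (l+1)/4·{(1+4/l)·Σ_p log(𝔡^K_p)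
  + (4/l)·Σ_p log(𝔰^ℚ_p) + (20/3)·l*_mod·Σ_p ι_p} − Σ_p (1/ℓ⋇)·Σ_j (j²/2l)·m_j(p)`;
* `negLogThetaNonarch_le_of_slotConstant` — the TEXT's form (Step (v) final display summed, p. 29–30) when every
  `Dloc p` has slot-constant `log(q_v)` (regime (a): one place of `F_mod` over each support prime, e.g. `F_mod = ℚ`);
* `hullEstimateOf_ofInput_of_slotConstant` — with the canonical `log(q_v)` exactly: `HullEstimateOf I δ_K`,
  `δ_K = (l+1)/4·{(1+4/l)·Σ_{p∈T(I)} log(𝔡^K_p) + (4/l)·Σ_p log(𝔰^ℚ_p) + (20/3)·l*_mod·Σ_p ι_p}` — the route-level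
  `Cor22.HullVolumeAtDatum` constant BEFORE the tower arithmetic of Steps (ii), (iii) ([IUTchIV] pp. 24–26:
  `log(𝔡^K) ≤ log(𝔡^{F_tpd}) + log(𝔣^{F_tpd}) + 2 log l + 21`, `log(𝔰^ℚ) ≤ 2·d_mod·(…) + log(2·3·5·l)`,
  `log(𝔰^≤) ≤ π(e*_mod·l)` — Props. 1.3/1.8, other seats' fields `K_le`/`sQ_le`/`sLe_le`).
Inputs throughout: local data `Dloc p` with `λ_v = [F₀_v:ℚ_p]` dominating the genuine quantities and the (R4)-shape
tameness input (a named hypothesis; [IUTchIV] (R4) p. 26 is Prop. 1.8 arithmetic of `K = F(E_F[l])`).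
[cite: Mochizuki2012, IUTchIV Thm. 1.10 proof Steps (v)–(viii) p. 27–30] [cite: DupuyHilado2025, §3.3, §3.9, §4.12]
[claim: Mochizuki2012, status: disputed] HONEST SCOPE: nothing asserts [IUTchIII] Cor. 3.12; without slot-constancy
only the λ_min form is derived; compare abc-iut-S2's unconditional `hullEstimateOf_ofInput` (c312-d1's
`explicitDelta`, which carries the slot term `θ(v_j) − min_a θ(v_a)`).
-/

noncomputable section

namespace Summit.ABC.IUTFork

namespace DHData

open Finset Literature.IUT.LogVolume Literature.IUT.LogVolume.Thm110Local NumberField IsDedekindDomain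

variable {F₀ : Type} [Field F₀] [NumberField F₀] {K : Type} [Field K] [NumberField K] [Algebra F₀ K]
variable (I : ThetaVolumeInput F₀ K)

/-! ## Summed over the support primes: `−|log(Θ)|`'s nonarchimedean part -/

/-- Rearranging a sum of the per-prime brackets. [folklore] -/
private theorem sum_bracket {ι : Type*} (s : Finset ι) (a c d m : ι → ℝ) (C k₁ k₃ k₄ : ℝ) :
    ∑ v ∈ s, (C * (k₁ * a v + k₃ * c v + k₄ * d v) - m v) =
      C * (k₁ * ∑ v ∈ s, a v + k₃ * ∑ v ∈ s, c v + k₄ * ∑ v ∈ s, d v) - ∑ v ∈ s, m v := by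
  rw [Finset.sum_sub_distrib, Finset.mul_sum, Finset.mul_sum, Finset.mul_sum, ← Finset.sum_add_distrib,
    ← Finset.sum_add_distrib, Finset.mul_sum]

/-- Rearranging a sum of the per-prime brackets (text's form). [folklore] -/
private theorem sum_bracket' {ι : Type*} (s : Finset ι) (a b c d : ι → ℝ) (C k₁ k₂ k₃ k₄ : ℝ) :
    ∑ v ∈ s, C * (k₁ * a v - k₂ * b v + k₃ * c v + k₄ * d v) =
      C * (k₁ * ∑ v ∈ s, a v - k₂ * ∑ v ∈ s, b v + k₃ * ∑ v ∈ s, c v + k₄ * ∑ v ∈ s, d v) := by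
  rw [Finset.mul_sum, Finset.mul_sum, Finset.mul_sum, Finset.mul_sum, ← Finset.sum_sub_distrib,
    ← Finset.sum_add_distrib, ← Finset.sum_add_distrib, Finset.mul_sum]

/-- **Steps (v)–(viii) for the genuine datum, `λ_min` form — NO hypothesis on the datum** (R2 of
plan/c312/STEPV-IND1-NOTE.md; abc-iut-S3's `Thm110MinVariant` shape): summing the per-prime `λ_min` bounds over
the support primes `T(I)` (off which nothing is summed: `T(I)` ⊇ `{2}`, the primes ramified in `K`, the residue
characteristics of `S`), `negLogThetaNonarch I ≤ (l+1)/4·{(1+4/l)·Σ_p log(𝔡^K_p) + (4/l)·Σ_p log(𝔰^ℚ_p) +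
(20/3)·l*_mod·Σ_p ι_p} − Σ_p (1/ℓ⋇)·Σ_j (j²/2l)·m_j(p)` for any local data `Dloc p` with the weights
`λ_v = [F₀_v:ℚ_p]` dominating the genuine quantities. The `q`-pilot enters ONLY through the weighted averages
`m_j(p)` of `min_a log(q_{v_a})` over collections. [cite: Mochizuki2012, IUTchIV Thm. 1.10 Steps (v)–(viii) p. 27–30]
[claim: Mochizuki2012, status: disputed] -/
theorem negLogThetaNonarch_le_min (Dloc : (p : ℕ) → DstLocal (placesOver F₀ p))
    (hlam : ∀ p ∈ I.supportPrimes, ∀ v : placesOver F₀ p, (Dloc p).lam v = localDegree F₀ v.1)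
    {lmod : ℝ} (hlmod : 0 ≤ lmod)
    (hDK : ∀ (p : ℕ) [hp : Fact p.Prime], p ∈ I.supportPrimes → ∀ v : placesOver F₀ p,
      differentOrd p ((I.σ.localFieldFamily p hp.out).k v) * Real.log p ≤ (Dloc p).logDK v)
    (hQ : ∀ p ∈ I.supportPrimes, ∀ v : placesOver F₀ p, (Dloc p).logQ v ≤ (ofInput I).logQloc p v)
    (hlogp : ∀ p ∈ I.supportPrimes, Real.log p ≤ (Dloc p).logp)
    (hR4 : ∀ (p : ℕ) [hp : Fact p.Prime], p ∈ I.supportPrimes → ∀ v : placesOver F₀ p,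
      p - 2 < absRamificationIdx p ((I.σ.localFieldFamily p hp.out).k v) →
      3 + Real.log (absRamificationIdx p ((I.σ.localFieldFamily p hp.out).k v)) ≤ 4 * (Dloc p).iota * lmod) :
    I.negLogThetaNonarch ≤
      ((I.X.l : ℝ) + 1) / 4 * ((1 + 4 / (I.X.l : ℝ)) * (∑ p ∈ I.supportPrimes, (Dloc p).avg (Dloc p).logDK)
          + 4 / (I.X.l : ℝ) * (∑ p ∈ I.supportPrimes, (Dloc p).logp)
          + 20 / 3 * lmod * (∑ p ∈ I.supportPrimes, (Dloc p).iota))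
        - ∑ p ∈ I.supportPrimes,
            procAvg I.X.lstar (fun j => (j : ℝ) ^ 2 / (2 * (I.X.l : ℝ)) * (Dloc p).minAvg j) := by
  rw [← negLogThetaDH_ofInput]
  have h0 := (ofInput I).negLogThetaDH_le_sum_dst (dst := I.supportPrimes) (fun p hp => hp) Dloc hlam
    (fun p hp hp' => absurd hp hp')
  refine h0.trans ?_
  have hsum : (∑ p ∈ I.supportPrimes, procAvg I.X.lstar (fun j => (Dloc p).wavg (j + 1)
        (fun e => (ofInput I).M.logμ ((ofInput I).M.hullUTheta (ofInput I).ind3 p j e)))) ≤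
      ∑ p ∈ I.supportPrimes, (((I.X.l : ℝ) + 1) / 4 * ((1 + 4 / (I.X.l : ℝ)) * (Dloc p).avg (Dloc p).logDK
          + 4 / (I.X.l : ℝ) * (Dloc p).logp + 20 / 3 * ((Dloc p).iota * lmod))
        - procAvg I.X.lstar (fun j => (j : ℝ) ^ 2 / (2 * (I.X.l : ℝ)) * (Dloc p).minAvg j)) := by
    refine Finset.sum_le_sum fun p hp => ?_
    haveI : Fact p.Prime := ⟨I.prime_of_mem_supportPrimes hp⟩
    exact procAvg_wavg_ofInput_le_min I (Dloc p) hlmod (hDK p hp) (hQ p hp) (hlogp p hp) (hR4 p hp)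
  refine hsum.trans (le_of_eq ?_)
  have e1 : (fun p => ((I.X.l : ℝ) + 1) / 4 * ((1 + 4 / (I.X.l : ℝ)) * (Dloc p).avg (Dloc p).logDK
          + 4 / (I.X.l : ℝ) * (Dloc p).logp + 20 / 3 * ((Dloc p).iota * lmod))
        - procAvg I.X.lstar (fun j => (j : ℝ) ^ 2 / (2 * (I.X.l : ℝ)) * (Dloc p).minAvg j)) =
      fun p => ((I.X.l : ℝ) + 1) / 4 * ((1 + 4 / (I.X.l : ℝ)) * (Dloc p).avg (Dloc p).logDK
          + 4 / (I.X.l : ℝ) * (Dloc p).logp + (20 / 3 * lmod) * (Dloc p).iota)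
        - procAvg I.X.lstar (fun j => (j : ℝ) ^ 2 / (2 * (I.X.l : ℝ)) * (Dloc p).minAvg j) := by
    funext p; ring
  rw [e1, sum_bracket]

/-- **Steps (v)–(viii) for the genuine datum, the TEXT's form, under SLOT-CONSTANCY** of the theta values over
every support prime (regime (a) of plan/c312/STEPV-IND1-NOTE.md: e.g. `F_mod` has a single place over each support
prime, in particular `F_mod = ℚ`): `negLogThetaNonarch I ≤ (l+1)/4·{(1+4/l)·Σ_p log(𝔡^K_p) − (1/6)·Σ_p log(q_p)
+ (4/l)·Σ_p log(𝔰^ℚ_p) + (20/3)·l*_mod·Σ_p ι_p}` — the sum over `v_ℚ ∈ 𝕍_ℚ^non` of the "procession-normalized upper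
bounds" of Steps (v), (vi) (p. 29–30), the nonarchimedean part of the shape of `Thm110Numerics.ProofData.hull_le`.
[cite: Mochizuki2012, IUTchIV Thm. 1.10 Steps (v)–(viii) p. 27–30] [claim: Mochizuki2012, status: disputed] -/
theorem negLogThetaNonarch_le_of_slotConstant (Dloc : (p : ℕ) → DstLocal (placesOver F₀ p))
    {lmod : ℝ} (hlmod : 0 ≤ lmod)
    (hDK : ∀ (p : ℕ) [hp : Fact p.Prime], p ∈ I.supportPrimes → ∀ v : placesOver F₀ p,
      differentOrd p ((I.σ.localFieldFamily p hp.out).k v) * Real.log p ≤ (Dloc p).logDK v)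
    (hQ : ∀ p ∈ I.supportPrimes, ∀ v : placesOver F₀ p, (Dloc p).logQ v ≤ (ofInput I).logQloc p v)
    (hlogp : ∀ p ∈ I.supportPrimes, Real.log p ≤ (Dloc p).logp)
    (hR4 : ∀ (p : ℕ) [hp : Fact p.Prime], p ∈ I.supportPrimes → ∀ v : placesOver F₀ p,
      p - 2 < absRamificationIdx p ((I.σ.localFieldFamily p hp.out).k v) →
      3 + Real.log (absRamificationIdx p ((I.σ.localFieldFamily p hp.out).k v)) ≤ 4 * (Dloc p).iota * lmod)
    (hlam : ∀ p ∈ I.supportPrimes, ∀ v : placesOver F₀ p, (Dloc p).lam v = localDegree F₀ v.1)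
    (hconst : ∀ p ∈ I.supportPrimes, ∀ v w : placesOver F₀ p, (Dloc p).logQ v = (Dloc p).logQ w) :
    I.negLogThetaNonarch ≤
      ((I.X.l : ℝ) + 1) / 4 * ((1 + 4 / (I.X.l : ℝ)) * (∑ p ∈ I.supportPrimes, (Dloc p).avg (Dloc p).logDK)
          - 1 / 6 * (∑ p ∈ I.supportPrimes, (Dloc p).avg (Dloc p).logQ)
          + 4 / (I.X.l : ℝ) * (∑ p ∈ I.supportPrimes, (Dloc p).logp)
          + 20 / 3 * lmod * (∑ p ∈ I.supportPrimes, (Dloc p).iota)) := by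
  rw [← negLogThetaDH_ofInput]
  have h0 := (ofInput I).negLogThetaDH_le_sum_dst (dst := I.supportPrimes) (fun p hp => hp) Dloc hlam
    (fun p hp hp' => absurd hp hp')
  refine h0.trans ?_
  have hsum : (∑ p ∈ I.supportPrimes, procAvg I.X.lstar (fun j => (Dloc p).wavg (j + 1)
        (fun e => (ofInput I).M.logμ ((ofInput I).M.hullUTheta (ofInput I).ind3 p j e)))) ≤
      ∑ p ∈ I.supportPrimes, ((I.X.l : ℝ) + 1) / 4 * ((1 + 4 / (I.X.l : ℝ)) * (Dloc p).avg (Dloc p).logDK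
          - 1 / 6 * (Dloc p).avg (Dloc p).logQ
          + 4 / (I.X.l : ℝ) * (Dloc p).logp + 20 / 3 * ((Dloc p).iota * lmod)) := by
    refine Finset.sum_le_sum fun p hp => ?_
    haveI : Fact p.Prime := ⟨I.prime_of_mem_supportPrimes hp⟩
    exact procAvg_wavg_ofInput_le I (Dloc p) hlmod (hDK p hp) (hQ p hp) (hlogp p hp) (hR4 p hp) (hconst p hp)
  refine hsum.trans (le_of_eq ?_)
  have e1 : (fun p => ((I.X.l : ℝ) + 1) / 4 * ((1 + 4 / (I.X.l : ℝ)) * (Dloc p).avg (Dloc p).logDK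
          - 1 / 6 * (Dloc p).avg (Dloc p).logQ
          + 4 / (I.X.l : ℝ) * (Dloc p).logp + 20 / 3 * ((Dloc p).iota * lmod))) =
      fun p => ((I.X.l : ℝ) + 1) / 4 * ((1 + 4 / (I.X.l : ℝ)) * (Dloc p).avg (Dloc p).logDK
          - 1 / 6 * (Dloc p).avg (Dloc p).logQ
          + 4 / (I.X.l : ℝ) * (Dloc p).logp + (20 / 3 * lmod) * (Dloc p).iota) := by
    funext p; ring
  rw [e1, sum_bracket']

/-- **THE COMPUTABLE HALF IN THE TEXT's SHAPE, under slot-constancy and the (R4)-shape input**: with the canonical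
`log(q_v)` EXACTLY (so that `Σ_p log(q_p) = log(q) = deĝ̲(𝔮)`, abc-iut-S2's `sum_avg_logQ_eq_ndeg`, and
`(l+1)/24·deĝ̲(𝔮) = deĝ̲_lgp(P_Θ)`), `HullEstimateOf I δ_K` HOLDS with
`δ_K = (l+1)/4·{(1+4/l)·Σ_{p∈T(I)} log(𝔡^K_p) + (4/l)·Σ_{p∈T(I)} log(𝔰^ℚ_p) + (20/3)·l*_mod·Σ_{p∈T(I)} ι_p}` — the
Step (v)–(viii) constant BEFORE the arithmetic of Steps (ii), (iii) ([IUTchIV] p. 24–26: `log(𝔡^K) ≤ log(𝔡^{F_tpd})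
+ log(𝔣^{F_tpd}) + 2·log l + 21`, `log(𝔰^ℚ) ≤ 2·d_mod·(…) + log(2·3·5·l)`, `log(𝔰^≤) ≤ π(e*_mod·l)`), which are
about the tower `F_mod ⊆ F_tpd ⊆ F ⊆ K` and not about log-volumes. Compare `hullEstimateOf_ofInput` (abc-iut-S2):
the same `Prop` with abc-iut-c312-d1's `explicitDelta`, unconditionally. [cite: Mochizuki2012, IUTchIV Thm. 1.10
Steps (v)–(viii) p. 27–30] [claim: Mochizuki2012, status: disputed] -/
theorem hullEstimateOf_ofInput_of_slotConstant (Dloc : (p : ℕ) → DstLocal (placesOver F₀ p))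
    {lmod : ℝ} (hlmod : 0 ≤ lmod)
    (hDK : ∀ (p : ℕ) [hp : Fact p.Prime], p ∈ I.supportPrimes → ∀ v : placesOver F₀ p,
      differentOrd p ((I.σ.localFieldFamily p hp.out).k v) * Real.log p ≤ (Dloc p).logDK v)
    (hQ : ∀ p ∈ I.supportPrimes, ∀ v : placesOver F₀ p, (Dloc p).logQ v = (ofInput I).logQloc p v)
    (hlogp : ∀ p ∈ I.supportPrimes, Real.log p ≤ (Dloc p).logp)
    (hR4 : ∀ (p : ℕ) [hp : Fact p.Prime], p ∈ I.supportPrimes → ∀ v : placesOver F₀ p,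
      p - 2 < absRamificationIdx p ((I.σ.localFieldFamily p hp.out).k v) →
      3 + Real.log (absRamificationIdx p ((I.σ.localFieldFamily p hp.out).k v)) ≤ 4 * (Dloc p).iota * lmod)
    (hlam : ∀ p ∈ I.supportPrimes, ∀ v : placesOver F₀ p, (Dloc p).lam v = localDegree F₀ v.1)
    (hconst : ∀ p ∈ I.supportPrimes, ∀ v w : placesOver F₀ p,
      (ofInput I).logQloc p v = (ofInput I).logQloc p w) :
    I.HullEstimateOf
      (((I.X.l : ℝ) + 1) / 4 * ((1 + 4 / (I.X.l : ℝ)) * (∑ p ∈ I.supportPrimes, (Dloc p).avg (Dloc p).logDK)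
          + 4 / (I.X.l : ℝ) * (∑ p ∈ I.supportPrimes, (Dloc p).logp)
          + 20 / 3 * lmod * (∑ p ∈ I.supportPrimes, (Dloc p).iota))) := by
  have h := negLogThetaNonarch_le_of_slotConstant I Dloc hlmod hDK (fun p hp v => (hQ p hp v).le) hlogp hR4
    hlam (fun p hp v w => by rw [hQ p hp v, hQ p hp w, hconst p hp v w])
  have hq : ∑ p ∈ I.supportPrimes, (Dloc p).avg (Dloc p).logQ = FinDivisor.ndeg F₀ I.X.qDivisor :=
    (ofInput I).sum_avg_logQ_eq_ndeg (fun _ hp => I.prime_of_mem_supportPrimes hp)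
      (fun _ hv => I.residueChar_mem_supportPrimes hv) Dloc hlam hQ
  unfold ThetaVolumeInput.HullEstimateOf
  rw [ndegLgp_thetaPilot_eq]
  rw [hq] at h
  linarith

/-! ## The constant made explicit: the canonical local data of the genuine input -/

/-- `HullEstimateOf` is monotone in the constant. [cite: DupuyHilado2025, §4.12] -/
theorem hullEstimateOf_mono {δ δ' : ℝ} (h : I.HullEstimateOf δ) (hle : δ ≤ δ') : I.HullEstimateOf δ' := by
  unfold ThetaVolumeInput.HullEstimateOf at h ⊢
  linarith

/-- **THE COMPUTABLE HALF WITH THE STEP (v)–(viii) CONSTANT EXPLICIT IN THE INPUT**, under slot-constancy of the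
canonical `log(q_v)` over every support prime and the (R4)-shape tameness input with a threshold `N` and a size
`l*` ([IUTchIV] (R4) p. 26: `N = e*_mod·l`, `l* = log(e*_mod·l)`): `HullEstimateOf I δ_K(I)` with
`δ_K(I) = (l+1)/4·{(1+4/l)·Σ_{p∈T(I)} (Σ_{v|p} n_v·d(K_{v̲}))/[F_mod:ℚ]·log p + (4/l)·Σ_{p∈T(I)} log p +
(20/3)·l*·#{p ∈ T(I) : p ≤ N}}` — `d(K_{v̲})` the different exponent of the genuine completion at the section's
place over `v`, `n_v = [F_mod,v : ℚ_p]` (for `K/F_mod` Galois the first sum is `log(𝔡^K)` restricted to `T(I)`;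
the second is `log(𝔰^ℚ)` and the count is `log(𝔰^≤)` of Step (iii), p. 25, over `T(I)`). The canonical local data:
`λ_v = n_v`, `log(𝔡^K_v) := d(K_{v̲})·log p`, `log(q_v) :=` the canonical value, `log(𝔰^ℚ_p) := log p`,
`ι_p := [p ≤ N]`. [cite: Mochizuki2012, IUTchIV Thm. 1.10 Steps (iii), (v)–(viii) p. 25–30] [claim: Mochizuki2012, status: disputed] -/
theorem hullEstimateOf_ofInput_explicit (N : ℕ) {lmod : ℝ} (hlmod : 0 ≤ lmod)
    (hR4 : ∀ (p : ℕ) [hp : Fact p.Prime], p ∈ I.supportPrimes → ∀ v : placesOver F₀ p,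
      p - 2 < absRamificationIdx p ((I.σ.localFieldFamily p hp.out).k v) →
      p ≤ N ∧ 3 + Real.log (absRamificationIdx p ((I.σ.localFieldFamily p hp.out).k v)) ≤ 4 * lmod)
    (hconst : ∀ p ∈ I.supportPrimes, ∀ v w : placesOver F₀ p,
      (ofInput I).logQloc p v = (ofInput I).logQloc p w) :
    I.HullEstimateOf
      (((I.X.l : ℝ) + 1) / 4 * ((1 + 4 / (I.X.l : ℝ)) *
          (∑ p ∈ I.supportPrimes, if hp : p.Prime then haveI : Fact p.Prime := ⟨hp⟩
            (∑ v : placesOver F₀ p, (localDegree F₀ v.1 : ℝ) *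
              differentOrd p ((I.σ.localFieldFamily p hp).k v)) / Module.finrank ℚ F₀ * Real.log p else 0)
        + 4 / (I.X.l : ℝ) * (∑ p ∈ I.supportPrimes, Real.log p)
        + 20 / 3 * lmod * ((I.supportPrimes.filter (· ≤ N)).card : ℝ))) := by
  classical
  -- the canonical local data at every index `p`
  let Dloc : (p : ℕ) → DstLocal (placesOver F₀ p) := fun p =>
    { lam := fun v => localDegree F₀ v.1
      lam_pos := fun v => by exact_mod_cast localDegree_pos F₀ v.1
      logDK := fun v => if hp : p.Prime then haveI : Fact p.Prime := ⟨hp⟩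
        differentOrd p ((I.σ.localFieldFamily p hp).k v) * Real.log p else 0
      logDK_nonneg := fun v => by
        split_ifs with hp
        · haveI : Fact p.Prime := ⟨hp⟩
          exact mul_nonneg (differentOrd_nonneg p _) (Real.log_natCast_nonneg p)
        · exact le_rfl
      logQ := fun v => (ofInput I).logQloc p v
      logQ_nonneg := fun v => (ofInput I).logQloc_nonneg p v
      logp := Real.log p
      logp_nonneg := Real.log_natCast_nonneg p
      iota := if p ≤ N then 1 else 0
      iota_nonneg := by split_ifs <;> norm_num }
  have hDK : ∀ (p : ℕ) [hp : Fact p.Prime], p ∈ I.supportPrimes → ∀ v : placesOver F₀ p,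
      differentOrd p ((I.σ.localFieldFamily p hp.out).k v) * Real.log p ≤ (Dloc p).logDK v := by
    intro p hp _ v
    show _ ≤ (if hp : p.Prime then _ else _)
    rw [dif_pos hp.out]
  have hR4' : ∀ (p : ℕ) [hp : Fact p.Prime], p ∈ I.supportPrimes → ∀ v : placesOver F₀ p,
      p - 2 < absRamificationIdx p ((I.σ.localFieldFamily p hp.out).k v) →
      3 + Real.log (absRamificationIdx p ((I.σ.localFieldFamily p hp.out).k v)) ≤ 4 * (Dloc p).iota * lmod := by
    intro p hp hpT v hv
    obtain ⟨hpN, hle⟩ := hR4 p hpT v hv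
    show _ ≤ 4 * (if p ≤ N then (1 : ℝ) else 0) * lmod
    rw [if_pos hpN, mul_one]
    exact hle
  have h := hullEstimateOf_ofInput_of_slotConstant I Dloc hlmod hDK (fun p _ v => rfl) (fun p _ => le_rfl) hR4'
    (fun p _ v => rfl) hconst
  refine hullEstimateOf_mono I h (le_of_eq ?_)
  -- identify the three sums
  have h1 : ∑ p ∈ I.supportPrimes, (Dloc p).avg (Dloc p).logDK =
      ∑ p ∈ I.supportPrimes, if hp : p.Prime then haveI : Fact p.Prime := ⟨hp⟩
        (∑ v : placesOver F₀ p, (localDegree F₀ v.1 : ℝ) *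
          differentOrd p ((I.σ.localFieldFamily p hp).k v)) / Module.finrank ℚ F₀ * Real.log p else 0 := by
    refine Finset.sum_congr rfl fun p hp => ?_
    have hp' : p.Prime := I.prime_of_mem_supportPrimes hp
    haveI : Fact p.Prime := ⟨hp'⟩
    have hDKv : ∀ v : placesOver F₀ p,
        (Dloc p).logDK v = differentOrd p ((I.σ.localFieldFamily p hp').k v) * Real.log p := by
      intro v
      show (if hp : p.Prime then _ else _) = _
      rw [dif_pos hp']
    rw [dif_pos hp', avg_eq_sum_div (Dloc p) (fun v => rfl), div_mul_eq_mul_div, Finset.sum_mul]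
    congr 1
    exact Finset.sum_congr rfl fun v _ => by rw [hDKv v]; ring
  have h3 : ∑ p ∈ I.supportPrimes, (Dloc p).iota = ((I.supportPrimes.filter (· ≤ N)).card : ℝ) := by
    show ∑ p ∈ I.supportPrimes, (if p ≤ N then (1 : ℝ) else 0) = _
    rw [Finset.sum_boole]
  rw [h1, h3]

/-- A number field of degree one has exactly one place over each prime (`Σ_{v|p} n_v = [F:ℚ] = 1`, `n_v ≥ 1`).
[folklore] -/
theorem placesOver_subsingleton_of_finrank_eq_one (hF : Module.finrank ℚ F₀ = 1) (p : ℕ) [Fact p.Prime]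
    (v w : placesOver F₀ p) : v = w := by
  classical
  by_contra hne
  have hne' : v.1 ≠ w.1 := fun h => hne (Subtype.ext h)
  have hsum := sum_localDegree F₀ p
  have h2 : localDegree F₀ v.1 + localDegree F₀ w.1 ≤ ∑ u ∈ placesOver F₀ p, localDegree F₀ u := by
    rw [← Finset.sum_pair hne']
    exact Finset.sum_le_sum_of_subset (by
      intro u hu
      rcases Finset.mem_insert.mp hu with rfl | hu
      · exact v.2
      · rw [Finset.mem_singleton.mp hu]; exact w.2)
  have hv := localDegree_pos F₀ v.1
  have hw := localDegree_pos F₀ w.1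
  omega

/-- **Slot-constancy is automatic for `F_mod` of degree one** (`F_mod = ℚ` up to isomorphism: regime (a) of
plan/c312/STEPV-IND1-NOTE.md at EVERY prime): any per-place quantity is constant on `V(F_mod)_p`. [folklore] -/
theorem slotConstant_of_finrank_eq_one (hF : Module.finrank ℚ F₀ = 1) {p : ℕ} [Fact p.Prime]
    (f : placesOver F₀ p → ℝ) (v w : placesOver F₀ p) : f v = f w := by
  rw [placesOver_subsingleton_of_finrank_eq_one hF p v w]

/-- **The computable half in the text's shape for `F_mod` of degree one**, from the (R4)-shape input alone.
[cite: Mochizuki2012, IUTchIV Thm. 1.10 Steps (v)–(viii) p. 27–30] [claim: Mochizuki2012, status: disputed] -/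
theorem hullEstimateOf_ofInput_explicit_of_finrank_eq_one (hF : Module.finrank ℚ F₀ = 1) (N : ℕ) {lmod : ℝ}
    (hlmod : 0 ≤ lmod)
    (hR4 : ∀ (p : ℕ) [hp : Fact p.Prime], p ∈ I.supportPrimes → ∀ v : placesOver F₀ p,
      p - 2 < absRamificationIdx p ((I.σ.localFieldFamily p hp.out).k v) →
      p ≤ N ∧ 3 + Real.log (absRamificationIdx p ((I.σ.localFieldFamily p hp.out).k v)) ≤ 4 * lmod) :
    I.HullEstimateOf
      (((I.X.l : ℝ) + 1) / 4 * ((1 + 4 / (I.X.l : ℝ)) *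
          (∑ p ∈ I.supportPrimes, if hp : p.Prime then haveI : Fact p.Prime := ⟨hp⟩
            (∑ v : placesOver F₀ p, (localDegree F₀ v.1 : ℝ) *
              differentOrd p ((I.σ.localFieldFamily p hp).k v)) / Module.finrank ℚ F₀ * Real.log p else 0)
        + 4 / (I.X.l : ℝ) * (∑ p ∈ I.supportPrimes, Real.log p)
        + 20 / 3 * lmod * ((I.supportPrimes.filter (· ≤ N)).card : ℝ))) :=
  hullEstimateOf_ofInput_explicit I N hlmod hR4 fun p hp v w => by
    haveI : Fact p.Prime := ⟨I.prime_of_mem_supportPrimes hp⟩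
    exact slotConstant_of_finrank_eq_one hF _ v w

end DHData

end Summit.ABC.IUTFork

end
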